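/-
Copyright: the b2b-balaban cell (near-miss cell 7), T⁴-continuum fan-out, lineage t4-ne7b-p2 (node U5c RENEWAL member).
Released under the licence of the surrounding project.
-/
import Literature.MathematicalPhysics.QuantumFieldTheory.Balaban1983to89.T4PersistenceRenewal

/-!
# The renewal route's one-event catalogue: positions cancel against the prepaid bank; the absorbed partner's mass

Summits-side support leaf of the T⁴-continuum cell (rung (B)+1 on a FINITE torus only; NOT infinite volume, NOT the
mass gap, NOT the Clay statement; NOT a proof of the spine estimate NE7b).  Lineage `t4-ne7b-p2` (generation 22),
node U5c, RENEWAL route; the arithmetic cores of leaves N3 and N5a of the ROUND-2 skeleton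
`t4/skeletons/NE7b-t4-ne7b-p2.md`.  [folklore] finite sums and geometric series; nothing is quoted from print, nothing
printed is asserted, no `[cite:]` tag; none of the cell's conditionals ((B), BetaPertH) occurs.

WHY.  The combined catalogue `hcat` of `RenewalGroveSum.forestDom_of_grove_sum` asks, for every parent record `P` and
age `s`, `Σ_{children c of P at age s} pr c·z₁^(booking c) ≤ εc` UNIFORMLY IN THE PARENT, although the one-event
extensions of a pending structure are as many as the positions in its zone (`N`, parent-dependent).  On the renewal route
the product majorant carries a prepaid size bank which makes the raw price of an edge carry the factor `1∕N` (skeleton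
N2); §1 is the resulting cancellation as a lemma.  §2 is the geometric sum behind the absorbed partner's mass (N5a).

WHAT.  §1 `sum_children_le_of_norm` (general form): children labelled injectively by (position `∈ Ps`, shape
`σ ∈ Shapes`), prices `x c ≤ φ (shape c)·a (pos c)` with position weights `a ≥ 0` of total `Σ_{Ps} a ≤ 1` ⇒
`Σ_children x ≤ Σ_{σ ∈ Shapes} φ σ` — parent-uniform; `sum_children_le_catalogue`: the case positions `< N`, `a ≡ 1∕N`
(prices `x c ≤ φ (shape c)∕N`); `sum_children_le_catalogue_sq`: the doubled bank, prices `x c ≤ φ (shape c)·(1∕N)²`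
(since `(1∕N)² ≤ 1∕N`).  §2 `partnerMass_le`: partners of age `a ≤ s` in `≤ c_N·Λ^a` cells each of pending mass
`≤ C_F·σ^a`, `Λσ < 1` ⇒ total `≤ c_N·C_F∕(1 − Λσ)`, free of `s`; `absorptionPrice_le`.  §3 decided toys.
(v1.1 = v1 p206884 with this paragraph reworded — XREAD l.5470 DOCFIX-2; declarations byte-identical.)

HONEST DEPENDENCY (cell): continuum YM on T⁴ ⇐ BetaPertH ∧ nine spine estimates (0/9 proved); BetaPertH ⇐ (D1) ∧ (D4)
∧ CAP+tail.  This file changes none of it.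
-/

open Finset

namespace Summit.QuantumFields.BalabanUV.T4Continuum.RenewalCatalogue

noncomputable section

/-! ## §1 Positions cancel: the per-parent sum against a parent-free shape catalogue -/

section Positions

variable {ι Sh Pos : Type*} [DecidableEq Sh] [DecidableEq Pos]

/-- **GENERAL NORMALISED FORM.**  Children `C` labelled injectively by (position `∈ Ps`, shape `∈ Shapes`), prices
`x c ≤ φ (shape c)·a (pos c)` with `φ ≥ 0` on the catalogue and position weights `a ≥ 0` of total `Σ_{Ps} a ≤ 1`
⇒ `Σ_{c ∈ C} x c ≤ Σ_{σ ∈ Shapes} φ σ`, whatever the (parent-dependent) position set. [folklore] -/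
theorem sum_children_le_of_norm (C : Finset ι) (Ps : Finset Pos) (Shapes : Finset Sh) (pos : ι → Pos) (shape : ι → Sh)
    (x : ι → ℝ) (φ : Sh → ℝ) (a : Pos → ℝ)
    (hinj : Set.InjOn (fun c => (pos c, shape c)) C) (hpos : ∀ c ∈ C, pos c ∈ Ps) (hshape : ∀ c ∈ C, shape c ∈ Shapes)
    (hφ : ∀ σ ∈ Shapes, 0 ≤ φ σ) (ha : ∀ p ∈ Ps, 0 ≤ a p) (hnorm : ∑ p ∈ Ps, a p ≤ 1)
    (hx : ∀ c ∈ C, x c ≤ φ (shape c) * a (pos c)) :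
    ∑ c ∈ C, x c ≤ ∑ σ ∈ Shapes, φ σ := by
  classical
  -- push the children into the product catalogue `Ps ×ˢ Shapes` along the injective labelling
  have hmaps : ∀ c ∈ C, (pos c, shape c) ∈ Ps ×ˢ Shapes :=
    fun c hc => Finset.mem_product.2 ⟨hpos c hc, hshape c hc⟩
  calc ∑ c ∈ C, x c ≤ ∑ c ∈ C, φ (shape c) * a (pos c) := Finset.sum_le_sum hx
    _ = ∑ q ∈ C.image (fun c => (pos c, shape c)), φ q.2 * a q.1 :=
        (Finset.sum_image (f := fun q : Pos × Sh => φ q.2 * a q.1) hinj).symm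
    _ ≤ ∑ q ∈ Ps ×ˢ Shapes, φ q.2 * a q.1 := by
        refine Finset.sum_le_sum_of_subset_of_nonneg (Finset.image_subset_iff.2 hmaps) fun q hq _ => ?_
        obtain ⟨h1, h2⟩ := Finset.mem_product.1 hq
        exact mul_nonneg (hφ _ h2) (ha _ h1)
    _ = ∑ p ∈ Ps, ∑ σ ∈ Shapes, φ σ * a p := Finset.sum_product _ _ _
    _ = (∑ p ∈ Ps, a p) * ∑ σ ∈ Shapes, φ σ := by
        rw [Finset.sum_mul]; refine Finset.sum_congr rfl fun p _ => ?_; rw [Finset.mul_sum]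
        exact Finset.sum_congr rfl fun σ _ => mul_comm _ _
    _ ≤ 1 * ∑ σ ∈ Shapes, φ σ :=
        mul_le_mul_of_nonneg_right hnorm (Finset.sum_nonneg hφ)
    _ = ∑ σ ∈ Shapes, φ σ := one_mul _

/-- **POSITIONS CANCEL AGAINST THE BANK.**  Children labelled injectively by (position `< N`, shape), prices
`x c ≤ φ (shape c)∕N` (the bank-normalised raw price of skeleton N2, single bank) ⇒ `Σ_children x ≤ Σ_{Shapes} φ`,
uniformly in `N`. [folklore] -/
theorem sum_children_le_catalogue (C : Finset ι) {N : ℕ} (hN : 0 < N) (Shapes : Finset Sh) (pos : ι → Fin N)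
    (shape : ι → Sh) (x : ι → ℝ) (φ : Sh → ℝ)
    (hinj : Set.InjOn (fun c => (pos c, shape c)) C) (hshape : ∀ c ∈ C, shape c ∈ Shapes)
    (hφ : ∀ σ ∈ Shapes, 0 ≤ φ σ) (hx : ∀ c ∈ C, x c ≤ φ (shape c) / N) :
    ∑ c ∈ C, x c ≤ ∑ σ ∈ Shapes, φ σ := by
  have hN' : (0 : ℝ) < N := by exact_mod_cast hN
  refine sum_children_le_of_norm C (Finset.univ : Finset (Fin N)) Shapes pos shape x φ (fun _ => 1 / (N : ℝ)) hinj
    (fun c _ => Finset.mem_univ _) hshape hφ (fun _ _ => by positivity) ?_ fun c hc => by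
      rw [← div_eq_mul_one_div]; exact hx c hc
  rw [Finset.sum_const, Finset.card_univ, Fintype.card_fin, nsmul_eq_mul]
  rw [mul_one_div_cancel hN'.ne']

/-- **THE DOUBLED BANK** (skeleton N2 uses `((κ p)∕N)²` so that a parent-free position weight `∝ 1∕(q+1)²` is
available): positions `< N`, prices `x c ≤ φ (shape c)·(1∕N)²` ⇒ `Σ_children x ≤ (1∕N)·Σ_{Shapes} φ ≤ Σ_{Shapes} φ`.
[folklore] -/
theorem sum_children_le_catalogue_sq (C : Finset ι) {N : ℕ} (hN : 0 < N) (Shapes : Finset Sh) (pos : ι → Fin N)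
    (shape : ι → Sh) (x : ι → ℝ) (φ : Sh → ℝ)
    (hinj : Set.InjOn (fun c => (pos c, shape c)) C) (hshape : ∀ c ∈ C, shape c ∈ Shapes)
    (hφ : ∀ σ ∈ Shapes, 0 ≤ φ σ) (hx : ∀ c ∈ C, x c ≤ φ (shape c) * (1 / (N : ℝ)) ^ 2) :
    ∑ c ∈ C, x c ≤ ∑ σ ∈ Shapes, φ σ := by
  have hN' : (0 : ℝ) < N := by exact_mod_cast hN
  have hN1 : (1 : ℝ) ≤ N := by exact_mod_cast hN
  refine sum_children_le_catalogue C hN Shapes pos shape x φ hinj hshape hφ fun c hc => (hx c hc).trans ?_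
  -- `φ·(1/N)² ≤ φ/N` since `1/N ≤ 1`
  have h1 : (1 / (N : ℝ)) ^ 2 ≤ 1 / (N : ℝ) := by
    rw [sq]
    exact mul_le_of_le_one_left (by positivity) ((div_le_one hN').2 hN1)
  calc φ (shape c) * (1 / (N : ℝ)) ^ 2 ≤ φ (shape c) * (1 / (N : ℝ)) :=
        mul_le_mul_of_nonneg_left h1 (hφ _ (hshape c hc))
    _ = φ (shape c) / N := by rw [mul_one_div]

end Positions

/-! ## §2 The absorbed partner's mass: a geometric sum over the partner's age -/

section Partner

/-- **THE ABSORBED PARTNER'S MASS IS `K`-FREE.**  At an absorption edge, a partner of age `a` is anchored in one of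
`≤ c_N·Λ^a` cells of its scale near the structure (`c_N` = the adjacency count of the structure's zone, cancelled later
by the bank) and the pending mass of one such slot at age `a` is `≤ C_F·σ^a` (the per-slot bound at the earlier
cutoff — induction on the cutoff, skeleton N5a); with `Λσ < 1` the total over ages `a ≤ s` is
`≤ c_N·C_F·(1∕(1 − Λσ))`, uniformly in `s`. [folklore] -/
theorem partnerMass_le {cN CF Λ σ : ℝ} (hcN : 0 ≤ cN) (hCF : 0 ≤ CF) (hΛ : 0 ≤ Λ) (hσ : 0 ≤ σ) (hr : Λ * σ < 1)
    (s : ℕ) (cells mass : ℕ → ℝ) (hcells : ∀ a ≤ s, cells a ≤ cN * Λ ^ a) (hmass0 : ∀ a ≤ s, 0 ≤ mass a)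
    (hmass : ∀ a ≤ s, mass a ≤ CF * σ ^ a) :
    ∑ a ∈ range (s + 1), cells a * mass a ≤ cN * CF * (1 / (1 - Λ * σ)) := by
  have hr0 : 0 ≤ Λ * σ := mul_nonneg hΛ hσ
  calc ∑ a ∈ range (s + 1), cells a * mass a ≤ ∑ a ∈ range (s + 1), cN * Λ ^ a * (CF * σ ^ a) := by
        refine Finset.sum_le_sum fun a ha => ?_
        have has : a ≤ s := Nat.lt_succ_iff.1 (Finset.mem_range.1 ha)
        exact mul_le_mul (hcells a has) (hmass a has) (hmass0 a has) (mul_nonneg hcN (pow_nonneg hΛ _))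
    _ = cN * CF * ∑ a ∈ range (s + 1), (Λ * σ) ^ a := by
        rw [Finset.mul_sum]; exact Finset.sum_congr rfl fun a _ => by rw [mul_pow]; ring
    _ ≤ cN * CF * (1 / (1 - Λ * σ)) := by
        refine mul_le_mul_of_nonneg_left ?_ (mul_nonneg hcN hCF)
        rw [one_div]
        calc ∑ a ∈ range (s + 1), (Λ * σ) ^ a ≤ ∑' a, (Λ * σ) ^ a :=
              (summable_geometric_of_lt_one hr0 hr).sum_le_tsum _ fun a _ => pow_nonneg hr0 a
          _ = (1 - Λ * σ)⁻¹ := tsum_geometric_of_lt_one hr0 hr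

/-- **… AND IT RIDES ON THE EDGE PRICE**: an absorption edge whose raw factor is `e·(1∕c_N)` (surplus × the bank's
cancellation of the adjacency count) times the partner mass `≤ c_N·C_F∕(1 − Λσ)` costs at most `e·C_F∕(1 − Λσ)` —
the inflated, `K`-free price of skeleton N3d. [folklore] -/
theorem absorptionPrice_le {e cN CF Λ σ M : ℝ} (he : 0 ≤ e) (hcN : 0 < cN) (hM : M ≤ cN * CF * (1 / (1 - Λ * σ))) :
    e * (1 / cN) * M ≤ e * (CF * (1 / (1 - Λ * σ))) := by
  have h : e * (1 / cN) * M ≤ e * (1 / cN) * (cN * CF * (1 / (1 - Λ * σ))) :=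
    mul_le_mul_of_nonneg_left hM (mul_nonneg he (by positivity))
  refine h.trans (le_of_eq ?_)
  field_simp

end Partner

/-! ## §3 Decided toys -/

section Toy

/-- **POSITIONS CANCEL, ON NUMBERS**: `N = 3` positions, two shapes of catalogue prices `1∕8` and `1∕16`; six children
(every (position, shape) pair), each priced exactly `φ∕3` ⇒ total `= 3·(1∕8 + 1∕16)∕3 = 3∕16 = Σ φ` (tight). -/
example : ∑ c ∈ (Finset.univ : Finset (Fin 3 × Bool)), (fun c : Fin 3 × Bool => (if c.2 then (1 : ℝ) / 8 else 1 / 16) / 3) c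
    ≤ ∑ σ ∈ (Finset.univ : Finset Bool), (fun σ : Bool => if σ then (1 : ℝ) / 8 else 1 / 16) σ :=
  sum_children_le_catalogue (Finset.univ : Finset (Fin 3 × Bool)) (by norm_num) Finset.univ Prod.fst Prod.snd _ _
    (fun c _ d _ h => Prod.ext (congrArg Prod.fst h) (congrArg Prod.snd h)) (fun _ _ => Finset.mem_univ _)
    (fun σ _ => by cases σ <;> norm_num) (fun c _ => le_rfl)

/-- the numbers: `6` children, total `3∕16`, catalogue `3∕16` — tight; and the partner sum at `Λ = 2`, `σ = 1∕4`,
`c_N = 5`, `C_F = 1`, ages `≤ 3`: `Σ_{a ≤ 3} 5·2^a·(1∕4)^a = 75∕8 ≤ 5·1·(1∕(1 − 1∕2)) = 10` -/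
example : (3 : ℚ) * ((1 / 8 + 1 / 16) / 3) = 1 / 8 + 1 / 16 ∧
    ∑ a ∈ range 4, (5 : ℚ) * 2 ^ a * (1 * (1 / 4) ^ a) = 75 / 8 ∧ (75 : ℚ) / 8 ≤ 5 * 1 * (1 / (1 - 2 * (1 / 4))) := by
  refine ⟨by norm_num, ?_, by norm_num⟩
  simp [Finset.sum_range_succ]; norm_num

/-- the partner lemma on the same numbers (reals) -/
example : ∑ a ∈ range (3 + 1), (fun a : ℕ => (5 : ℝ) * 2 ^ a) a * (fun a : ℕ => (1 : ℝ) * (1 / 4) ^ a) a ≤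
    5 * 1 * (1 / (1 - 2 * (1 / 4))) :=
  partnerMass_le (by norm_num) (by norm_num) (by norm_num) (by norm_num) (by norm_num) 3 _ _ (fun a _ => le_rfl)
    (fun a _ => by positivity) (fun a _ => le_rfl)

end Toy

end

end Summit.QuantumFields.BalabanUV.T4Continuum.RenewalCatalogue
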